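import Literature.AlgebraicGeometry.Hu2025.Statements.S08MainTheorem.R110aSmooth
import Literature.AlgebraicGeometry.Motives.Varieties
import Mathlib.FieldTheory.Perfect
import Mathlib.Data.Real.Basic
import Mathlib.LinearAlgebra.AffineSpace.AffineSubspace.Defs
import Mathlib.LinearAlgebra.Dimension.Finrank
import Mathlib.RingTheory.Localization.Away.Basic
import Mathlib.AlgebraicGeometry.AffineSpace
import Mathlib.AlgebraicGeometry.Morphisms.FinitePresentation
import HarnessLib

/-!
# Hu 2025 (arXiv:2507.21400v1) §9 (matroids `d = (d_I)`, `Δ^{d,n}_d`, Prop. 9.1, Thm. 9.2 / 9.3 / 9.4), §1 (Thm. 1.1 and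
# the deduction sentences C09L16 / C09L21) and the [Hu22] sentences Thm 1.1 (p.2) and P133L11 (joint J2 = G-H10) —
# row 110 file `c` = `S01S09Interface/R110cUniversalityInterface.lean`, STATEMENTS-FIRST (rung M-Hu-min, D-0089).
# PRE-DRAFT by res-type-024 (gen 6; v3.3 gen 11); NOT FILED before the 08:00Z re-pointing line names the row-110 owner.

**Status of the sources (D-0012): UNREFEREED PREPRINTS UNDER ADJUDICATION.** [Hu25] = Y. Hu, *Universal
characteristic-free resolution of singularities, I*, arXiv:2507.21400v1 (2025), TeX chunks `p0001…p0073` (locator of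
record `chunk p<cc> l.<a>–<b>` = `C<cc>L<l>`, next to it the arXiv-v1 PDF page, cross-checked on the PDF text layer
`lit/res-lit-6/hu25/text`); [Hu22] = Y. Hu, arXiv:2203.03842v4 (2022), locator `p.N l.a–b` = `Hu22P<ppp>L<l>`. Every
statement is typed as a `def … : Prop` CANDIDATE / real definition / STRUCTURE whose fields quote the printed
requirements, tagged `[claim: Hu2025 | Hu2022, status: under-review]`, consumed only as a hypothesis, never asserted; no
decl takes a side. No proofs, no `sorry`, no `instance`, no notation. AI typing is weaker than expert review.
STATUS: candidate statements under adjudication (D-0012/D-0089); not asserted.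

ROW-110 FILE LAYOUT (v3/v3.3; tables and rationale in HOME/plan/tools/res-type-024/hu/README-hu110-bc.md and v3.3/README-v3.3.md):
a `S08MainTheorem/R110aSmooth` (I-SM) · b `S08MainTheorem/R110bMainTheorems` (§8.1 + chart content of Thm 8.5) · c THIS FILE ·
d `S08MainTheorem/R110dEllTransform` (Z_Γ, the ℓ-transform tower, Thm8_5/8_6/1_3) · e `S01S09Interface/R110eGammaOfMatroid` (Γ_d, Hu22Setup).

THIS FILE (deps: a `R110aSmooth` + `Literature.AlgebraicGeometry.Motives.Varieties` + Mathlib). Read for it: [Hu25] chunks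
p0072 (whole), p0003 (l.1–25), p0008 (l.95–121), p0009 (l.10–25); [Hu22] pp.130–133 (`~/.lit/texts/paper-arxiv-2203.03842/`);
PDF p.159–161, p.3, p.17. §9 of [Hu25] REVIEWS [La03] (Lafforgue, *Chirurgie des grassmanniennes*, NOT HELD, acq-07745):
every §9 decl carries «secondary: restated from Lafforgue2003 …; primary unread»; [LV12] (Lee–Vakil, HELD) is the refereed
Mnëv–Sturmfels universality for singularity TYPES and is NOT the matroid-stratum / torus-quotient statement of Thm 9.4.
Rendering choices (each a choice for the lanes; none takes a side): matroids AS PRINTED (`HuMatroid`, supermodular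
`d_I = dim(F ∩ E_I)`, not Mathlib's `Matroid`; `[n] ↦ Fin n`); Prop. 9.1 and «acts freely» READ AT FIELD-VALUED POINTS of
the Grassmannian (`InStratum`, `PlueckerNonzero` = bijectivity of the coordinate projection `F → K^u`, `TorusFreeOnCell`);
the scheme-structure clause of Prop. 9.1 is not typed; «any matroid … as considered above» (Prop. 9.1, Thm 9.3) is typed
TWICE (T5 / PARTITION-HU §6 (e), on the lane-A pre-read note res-ref-a13 2026-08-27T06:29:49Z): LITERALLY over every
family with the three printed properties (`Prop9_1`, `Thm9_3_torus`) and, as the siblings `Prop9_1_ours` /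
`Thm9_3_torus_ours`, over the families that index a stratum OCCURRING in the printed decomposition (`HuMatroid.IsRealisable`:
`Gr_d` has a field-valued point); the [La03] objects (configuration space, PGL- and torus-quotients)
are the fields of the STRUCTURE `LafforgueObjects` («EXISTENCE / CONSTRUCTION NOT SHOWN IN PRINT; secondary; primary
unread») and Thm 9.2 / 9.4 are PROPERTIES of such a datum; «`X × 𝔸^r`» = Mathlib `𝔸(Fin r; X)`, «open subset `U` …
projecting (surjectively) onto `X`» = `U : Opens` with `U.ι ≫ (𝔸 ↘ X)` surjective; [Hu22] p.133 l.11–14 is typed at RING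
level on one trivialising open `O` with the identification of the printed objects as the parameter `hSetup : Prop`.
`Γ_d` ON THE PLATFORM (needs row 101's index sets) and the [Hu22] p.131 diagram (needs `Z_Γ` as a scheme, file d) are in
file e. Universe `0` for §9 (the platform's `plVar n : Type`); the §1/[Hu22] theorems are universe-polymorphic.
-/

noncomputable section

open _root_.CategoryTheory _root_.CategoryTheory.Limits _root_.AlgebraicGeometry _root_.MvPolynomial

namespace Literature.AlgebraicGeometry.Hu2025.Statements.S01S09Interface

open Literature.AlgebraicGeometry.Hu2025.Statements.S08MainTheorem
open Literature.AlgebraicGeometry.Motives Literature.AlgebraicGeometry.Resolution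

universe u

/-! ## §9 (chunk p0072 l.20–60; PDF p.159) — matroids `d = (d_I)`, `Δ^{d,n}`, `x_u`, `Δ^{d,n}_d` («secondary: restated from Lafforgue2003; primary unread (acq-07745)») -/

/-- **Hu 2025, §9, «matroid of rank `d` on the set `[n]`» AS PRINTED** (chunk p0072 l.26–34; PDF p.159 L015–L021),
verbatim: «indexed by the family `d = (d_I)_{I ⊂ [n]}` of nonnegative integers `d_I ∈ ℕ` verifying • `d_∅ = 0`,
`d_[n] = d`, • `d_I + d_J ≤ d_{I∪J} + d_{I∩J}`, for all `I, J ⊂ [n]`. The family `d` is called a matroid of rank `d` on the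
set `[n]`.» (Lafforgue's `d_I = dim(F ∩ E_I)`, hence SUPERmodular; this is not Mathlib's `Matroid` — no bridge is
asserted; `[n] ↦ Fin n`.) secondary: restated from Lafforgue2003 (via [Hu25] §9); primary unread (acq-07745).
[claim: Hu2025, status: under-review]
STATUS: candidate statement under adjudication (D-0012/D-0089); not asserted. -/
structure HuMatroid (n d : ℕ) where
  /-- `d_I` for `I ⊂ [n]` -/
  dI : Finset (Fin n) → ℕ
  /-- «`d_∅ = 0`» -/
  dI_empty : dI ∅ = 0
  /-- «`d_[n] = d`» -/
  dI_univ : dI Finset.univ = d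
  /-- «`d_I + d_J ≤ d_{I∪J} + d_{I∩J}`» -/
  dI_supermod : ∀ I J : Finset (Fin n), dI I + dI J ≤ dI (I ∪ J) + dI (I ∩ J)

/-- **Hu 2025, §9, the polytope `Δ^{d,n}`** (chunk p0072 l.37–40; PDF p.159 L025–L026), verbatim: «`Δ^{d,n} = {(x_1, ⋯, x_n)
∈ ℝ^n ∣ 0 ≤ x_α ≤ 1, ∀ α; x_1 + ⋯ + x_n = d}`». secondary: restated from Lafforgue2003; primary unread.
[claim: Hu2025, status: under-review]
STATUS: candidate statement under adjudication (D-0012/D-0089); not asserted. -/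
def hypersimplex (n d : ℕ) : Set (Fin n → ℝ) :=
  {x | (∀ α, 0 ≤ x α ∧ x α ≤ 1) ∧ ∑ α, x α = d}

/-- **Hu 2025, (9.1), the vertex `x_i` of a subset** (chunk p0072 l.42–50; PDF p.159 L027–L033), verbatim: «For any
`i = (i_1, ⋯, i_3) ∈ 𝕀_{3,n}`, we let `x_i = (x_1, ⋯, x_n)` be defined by `x_i = 1` if `i ∈ i`, `x_i = 0` otherwise.»
(typed for any subset `u ⊆ [n]`). [claim: Hu2025, status: under-review]
STATUS: candidate statement under adjudication (D-0012/D-0089); not asserted. -/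
def vertexOf {n : ℕ} (u : Finset (Fin n)) : Fin n → ℝ :=
  fun α => if α ∈ u then 1 else 0

/-- **Hu 2025, (9.1)** — numbered alias of `vertexOf` (chunk p0072 l.42–50; PDF p.159 eq. (9.1)).
[claim: Hu2025, status: under-review]
STATUS: candidate statement under adjudication (D-0012/D-0089); not asserted. -/
abbrev Eq9_1 {n : ℕ} (u : Finset (Fin n)) : Fin n → ℝ := vertexOf u

/-- **Hu 2025, §9, unnumbered claim** (chunk p0072 l.52–53; PDF p.159 L034–L035), verbatim: «It is known that
`Δ^{d,n} ∩ ℕ^n = {x_i ∣ i ∈ 𝕀_{3,n}}` and it consists of precisely the vertices of the polytope `Δ^{d,n}`.» Typed: the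
lattice points of `Δ^{d,n}` (coordinates in `ℕ`) are exactly the `x_u`, `|u| = d` (sic: the text writes `𝕀_{3,n}` for
general `d`; `d = 3` in use). The «vertices» clause (convex geometry) is not typed. secondary: restated from
Lafforgue2003; primary unread. [claim: Hu2025, status: under-review]
STATUS: candidate statement under adjudication (D-0012/D-0089); not asserted. -/
def C72L52 (n d : ℕ) : Prop :=
  ∀ x : Fin n → ℝ, (x ∈ hypersimplex n d ∧ ∀ α, ∃ m : ℕ, x α = m) ↔ ∃ u : Finset (Fin n), u.card = d ∧ x = vertexOf u

/-- **Hu 2025, §9, the matroid subpolytope `Δ^{d,n}_d`** (chunk p0072 l.55–60; PDF p.159 L036–L043), verbatim: «the matroid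
`d = (d_I)_{I ⊂ [n]}` above defines the following subpolytope of `Δ^{d,n}`: `Δ^{d,n}_d = {(x_1, ⋯, x_n) ∈ Δ^{d,n} ∣
Σ_{α ∈ I} x_α ≥ d_I, ∀ I ⊂ [n]}`. This is called the matroid subpolytope of `Δ^{d,n}` corresponding to `d`.»
secondary: restated from Lafforgue2003; primary unread. [claim: Hu2025, status: under-review]
STATUS: candidate statement under adjudication (D-0012/D-0089); not asserted. -/
def matroidPolytope {n d : ℕ} (M : HuMatroid n d) : Set (Fin n → ℝ) :=
  {x | x ∈ hypersimplex n d ∧ ∀ I : Finset (Fin n), (M.dI I : ℝ) ≤ ∑ α ∈ I, x α}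

/-- **`x_u ∈ Δ^{d,n}_d` for a `d`-subset `u`, COMBINATORIALLY** (reading of chunk p0072 l.55–60 at the lattice points
(9.1)): `Σ_{α∈I} (x_u)_α = |u ∩ I|`, so `x_u ∈ Δ^{d,n}_d ↔ |u| = d ∧ ∀ I, d_I ≤ |u ∩ I|` — the decidable form in which
Prop. 9.1 and (9.2) use the condition «`x_i ∈ Δ^{d,n}_d`». The equivalence with `vertexOf u ∈ matroidPolytope M` is a
bookkeeping fact, not proved in this statements file. [claim: Hu2025, status: under-review]
STATUS: candidate statement under adjudication (D-0012/D-0089); not asserted. -/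
def VertexMem {n d : ℕ} (M : HuMatroid n d) (u : Finset (Fin n)) : Prop :=
  u.card = d ∧ ∀ I : Finset (Fin n), M.dI I ≤ (u ∩ I).card

/-- **Bridge to row 101's index set `𝕀_{3,n}`** (I-PL: increasing triples `(u₁,u₂,u₃) : ℕ × ℕ × ℕ`, `1 ≤ u₁ < u₂ < u₃ ≤ n`;
`{u₁,u₂,u₃}` = row 101's `S03Pluecker.triSet u`, inlined so that this file needs no row-101 import): the triple as a subset of `[n] = Fin n` (shift by one). OURS bookkeeping.
[claim: Hu2025, status: under-review]
STATUS: candidate statement under adjudication (D-0012/D-0089); not asserted. -/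
def tripleSet (n : ℕ) (u : ℕ × ℕ × ℕ) : Finset (Fin n) :=
  Finset.univ.filter fun i => i.val + 1 ∈ ({u.1, u.2.1, u.2.2} : Finset ℕ)

/-! ## Prop. 9.1 (chunk p0072 l.71–80; PDF p.160) — the matroid Schubert cell by its Plücker coordinates (READING at field-valued points) -/

section Points

variable (K : Type) [Field K] {n : ℕ}

/-- **`E_I = ⊕_{α ∈ I} E_α ⊂ E = K^n`** (chunk p0072 l.11–14; PDF p.159 L004–L009: «`E_I = ⊕_{α∈I} E_α, ∀ I ⊂ [n]`,
`E := E_{[n]}`», `E_α` of dimension 1): the coordinate subspace of `Fin n → K` supported on `I`.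
secondary: restated from Lafforgue2003; primary unread. [claim: Hu2025, status: under-review]
STATUS: candidate statement under adjudication (D-0012/D-0089); not asserted. -/
def coordSubspace (I : Finset (Fin n)) : Submodule K (Fin n → K) :=
  Submodule.pi ((↑I : Set (Fin n))ᶜ) fun _ => ⊥

/-- **«`Gr^{3,E}_d = {F ↪ E ∣ dim(F ∩ E_I) = d_I, ∀ I ⊂ [n]}`», the matroid Schubert cell at `K`-points** (chunk p0072
l.22–24; PDF p.159 L012–L017): a `d`-dimensional subspace `F ≤ K^n` lies in the stratum of `d` iff
`dim_K(F ∩ E_I) = d_I` for all `I`. secondary: restated from Lafforgue2003; primary unread.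
[claim: Hu2025, status: under-review]
STATUS: candidate statement under adjudication (D-0012/D-0089); not asserted. -/
def InStratum {d : ℕ} (M : HuMatroid n d) (F : Submodule K (Fin n → K)) : Prop :=
  Module.finrank K F = d ∧ ∀ I : Finset (Fin n), Module.finrank K ↥(F ⊓ coordSubspace K I) = M.dI I

/-- **The matroid Schubert cell `Gr^{3,E}_d` as the SET of its `K`-points** (chunk p0072 l.22–24, l.35 «The stratum
`Gr^{3,E}_d` is called a matroid Schubert cell»; PDF p.159 L012–L021): `{F ≤ K^n ∣ InStratum K d F}` — PARTITION-HU row 110's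
name for the object; the predicate form is `InStratum`. secondary: restated from Lafforgue2003; primary unread (acq-07745).
[claim: Hu2025, status: under-review]
STATUS: candidate statement under adjudication (D-0012/D-0089); not asserted. -/
def matroidSchubertCell {d : ℕ} (M : HuMatroid n d) : Set (Submodule K (Fin n → K)) :=
  {F | InStratum K M F}

/-- **«`p_u ≠ 0`» at a `K`-point `F` of the Grassmannian, basis-free** (the Plücker coordinate `p_u(F)`, `|u| = dim F`, is
the `u`-minor of a basis matrix; it is non-zero iff the coordinate projection `F → K^u` is bijective): OURS rendering of
the symbol used in Prop. 9.1 (chunk p0072 l.77–80). [claim: Hu2025, status: under-review]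
STATUS: candidate statement under adjudication (D-0012/D-0089); not asserted. -/
def PlueckerNonzero (F : Submodule K (Fin n → K)) (u : Finset (Fin n)) : Prop :=
  Function.Bijective fun v : F => fun i : ↥u => (v : Fin n → K) i

/-- **Hu 2025, Proposition 9.1 (Proposition, p.4, [La03])** (chunk p0072 l.71–80; PDF p.160), verbatim: «Let `d` be any
matroid of rank `d` on the set `[n]` as considered above. Then, in the Grassmannian `Gr^{3,E} ↪ ℙ(∧³E) = {(p_i)_{i ∈
𝕀_{3,n}} ∈ 𝔾_m ∖ (∧³E ∖ {0})}` [sic: `d = 3` in the exponent], the matroid Schubert cell `Gr^{3,E}_d`, as a locally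
closed subscheme, is defined by `p_i = 0, ∀ x_i ∉ Δ^{d,n}_d`, `p_i ≠ 0, ∀ x_i ∈ Δ^{d,n}_d`.» READING AT FIELD-VALUED
POINTS (module docstring): for every field `K` and every `d`-dimensional `F ≤ K^n`, `F` is in the stratum of `d` iff
for every `d`-subset `u`, `p_u(F) ≠ 0 ↔ x_u ∈ Δ^{d,n}_d` (combinatorial `VertexMem`). The scheme-structure clause is not
typed. «As considered above» READ LITERALLY (AS PRINTED): every family with the three printed properties of l.28–34
(`HuMatroid`). Lane-A pre-read note (res-ref-a13, STATUS 2026-08-27T06:29:49Z): those properties alone admit families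
whose cell is empty at every field-valued point while the displayed locus is not (`n = 3`, `d = 2`, `d_I = 0` for
`I ≠ [3]`: every 2-plane `F ≤ K^3` has `dim(F ∩ E_{12}) ≥ 1 ≠ d_{12}`, yet `F = ⟨e₁+e₂, e₂+e₃⟩` has all `p_u(F) ≠ 0` and all
`x_u ∈ Δ^{2,3}_d`); the reading it asked for — over the strata OCCURRING in the decomposition of l.24–28 — is the sibling
`Prop9_1_ours` (T5; PARTITION-HU §6 (e): the adjudication reads both); this decl keeps the printed wording. secondary:
restated from Lafforgue2003 Prop. p.4; primary unread (acq-07745). [claim: Hu2025, status: under-review]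
STATUS: candidate statement under adjudication (D-0012/D-0089); not asserted. -/
def Prop9_1 {d : ℕ} (M : HuMatroid n d) : Prop :=
  ∀ (K : Type) [Field K] (F : Submodule K (Fin n → K)), Module.finrank K F = d →
    (InStratum K M F ↔ ∀ u : Finset (Fin n), u.card = d → (PlueckerNonzero K F u ↔ VertexMem M u))

/-- **The stratum `Gr^{3,E}_d` OCCURS in the decomposition** (chunk p0072 l.24–28; PDF p.159 L012–L017: «decomposes into
a disjoint union of locally closed strata `Gr^{3,E}_d = {F ↪ E ∣ dim(F ∩ E_I) = d_I, ∀ I ⊂ [n]}` indexed by the family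
`d = (d_I)`»), READ AT FIELD-VALUED POINTS: there are a field `K` and a `d`-plane `F₀ ≤ K^n` with `dim_K(F₀ ∩ E_I) = d_I`
for all `I` (then `d_I = d − rk_{F₀}([n] ∖ I)`, a matroid in the usual sense, and `x_u ∈ Δ^{d,n}_d` iff `u` is a basis of
it). OURS bookkeeping: the binder by which `Prop9_1_ours` / `Thm9_3_torus_ours` read «any matroid … as considered above»
(lane-A pre-read note res-ref-a13 2026-08-27T06:29:49Z). secondary: restated from Lafforgue2003; primary unread
(acq-07745). [claim: Hu2025, status: under-review]
STATUS: candidate statement under adjudication (D-0012/D-0089); not asserted. -/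
def HuMatroid.IsRealisable {d : ℕ} (M : HuMatroid n d) : Prop :=
  ∃ (K₀ : Type) (_ : Field K₀) (F₀ : Submodule K₀ (Fin n → K₀)), InStratum K₀ M F₀

/-- **Hu 2025, Proposition 9.1 — READING over the OCCURRING strata (OURS sibling of `Prop9_1`)** (chunk p0072 l.71–80 with
l.24–28; PDF p.160/p.159): for every family `d` indexing a stratum that occurs in the decomposition (`HuMatroid.IsRealisable`:
`Gr^{3,E}_d` has a field-valued point), the field-valued-points reading `Prop9_1 d` (for every field `K` and `d`-plane
`F ≤ K^n`: `F ∈ Gr^{3,E}_d` iff `p_u(F) ≠ 0 ↔ x_u ∈ Δ^{d,n}_d` for every `d`-subset `u`). The reading the lane-A pre-read note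
(res-ref-a13, STATUS 2026-08-27T06:29:49Z) asked for; the antecedent is NOT printed in Prop. 9.1 itself — labelled OURS; the
printed wording is `Prop9_1`. secondary: restated from Lafforgue2003 Prop. p.4; primary unread (acq-07745).
[claim: Hu2025, status: under-review]
STATUS: candidate statement under adjudication (D-0012/D-0089); not asserted. -/
def Prop9_1_ours {d : ℕ} (M : HuMatroid n d) : Prop :=
  M.IsRealisable → Prop9_1 M

/-- **«`(𝔾ⁿ_m/𝔾_m)` acts freely on the matroid Schubert cell `Gr^{3,E}_d`»** (Thm 9.4 chunk p0072 l.121; Thm 9.3 l.110–111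
«the action of `𝔾ⁿ_m/𝔾_m` on `Gr^{d,n}_d` is free») READ AT FIELD-VALUED POINTS: for every field `K`, every `F` in the
stratum and every `t ∈ (K^×)^n`, if the diagonal action `v ↦ (t_α v_α)_α` maps `F` into itself then `t` is scalar
(`t_α = t_β`), i.e. the stabiliser of every point is the diagonal `𝔾_m`. (Scheme-theoretic freeness of the action =
triviality of stabiliser group schemes; this is its statement on field-valued points — READING, labelled.) secondary:
restated from Lafforgue2003; primary unread. [claim: Hu2025, status: under-review]
STATUS: candidate statement under adjudication (D-0012/D-0089); not asserted. -/
def TorusFreeOnCell {d : ℕ} (M : HuMatroid n d) : Prop :=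
  ∀ (K : Type) [Field K] (F : Submodule K (Fin n → K)), InStratum K M F →
    ∀ t : Fin n → Kˣ, (∀ v ∈ F, (fun α => (t α : K) * v α) ∈ F) → ∀ α β : Fin n, t α = t β

end Points

/-- **Hu 2025, Theorem 9.3 (Gelfand, MacPherson, Theorem I.11, [La03]) — the TORUS clause** (chunk p0072 l.106–115; PDF
p.160; = [Hu22] Thm 9.3 p.130 l.18–36) [OPT item], verbatim: «… Similarly, the action of `𝔾ⁿ_m/𝔾_m` on `Gr^{d,n}_d` is
free if and only if `dim_ℝ Δ^{d,n}_d = n − 1`. …» Typed: `TorusFreeOnCell M ↔` the affine dimension of the matroid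
polytope (Mathlib `Module.finrank ℝ (vectorSpan ℝ Δ^{d,n}_d)`) is `n − 1`. The `PGL_{d−1}`-on-`C^{d,n}_d` clause and the
«canonically identified» clause refer to [La03] objects and are fields/omitted (see `LafforgueObjects`). secondary:
restated from Lafforgue2003 Thm I.11; primary unread. [claim: Hu2025, status: under-review]
STATUS: candidate statement under adjudication (D-0012/D-0089); not asserted. -/
def Thm9_3_torus {n d : ℕ} (M : HuMatroid n d) : Prop :=
  TorusFreeOnCell M ↔ Module.finrank ℝ ↥(vectorSpan ℝ (matroidPolytope M)) = n - 1

/-- **Hu 2025, Theorem 9.3, TORUS clause — READING over the OCCURRING strata (OURS sibling of `Thm9_3_torus`)** [OPT item]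
(chunk p0072 l.106–115 with l.24–28; PDF p.160/p.159): Thm 9.3 also says «any matroid … as considered above» (l.107); for a
family whose cell is empty at every field-valued point `TorusFreeOnCell` holds vacuously whatever `dim_ℝ Δ^{d,n}_d` is (e.g.
`n = 3`, `d = 2`, `d_I = 2·[1 ∈ I]`: the three printed properties hold and `Δ^{2,3}_d = ∅`; lane-A pre-read note res-ref-a13
2026-08-27T06:29:49Z, «weaker caveat»), so the clause is also typed under `HuMatroid.IsRealisable` («the strata that
occur»). The antecedent is NOT printed in Thm 9.3 itself — labelled OURS; the printed wording is `Thm9_3_torus`.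
secondary: restated from Lafforgue2003 Thm I.11; primary unread (acq-07745). [claim: Hu2025, status: under-review]
STATUS: candidate statement under adjudication (D-0012/D-0089); not asserted. -/
def Thm9_3_torus_ours {n d : ℕ} (M : HuMatroid n d) : Prop :=
  M.IsRealisable → Thm9_3_torus M

/-- **Hu 2025, Theorem 9.3** — numbered alias (PARTITION-HU row 110 [OPT] name) of the TYPED part `Thm9_3_torus` (the torus
clause, chunk p0072 l.109–111); the `PGL_{d−1}`-on-`C^{d,n}_d` clause and the «canonically identified» clause concern the
[La03] objects recorded as fields of `LafforgueObjects` and are not typed as Props. secondary: restated from Lafforgue2003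
Thm I.11; primary unread (acq-07745). [claim: Hu2025, status: under-review]
STATUS: candidate statement under adjudication (D-0012/D-0089); not asserted. -/
abbrev Thm9_3 {n d : ℕ} (M : HuMatroid n d) : Prop := Thm9_3_torus M

/-! ## Thm. 9.2 / 9.4 (chunk p0072 l.82–124; PDF p.160–161) over the [La03] objects -/

/-- **The objects [Hu25] §9 takes from [La03] without construction** (chunk p0072 l.82–95 «the configuration space
`C^{d,n}_d` defined by the matroid `d` is the classifying scheme of families of `n` points `P_1, ⋯, P_n` on the projective
space `ℙ^{d−1}` such that … `dim P_I = d − 1 − d_I`»; l.99–104 «`PGL_3` acts freely on the configuration space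
`C^{3,n}_d` … the quotient space `C^{3,n}_d := C^{3,n}_d/PGL_3`» [sic: underlined]; l.120–124 «the quotient space
`Gr̄^{3,E}_d := Gr^{3,E}_d/(𝔾ⁿ_m/𝔾_m)`»), for rank `3`: per `n` and matroid `d`, the configuration scheme `conf`, the
predicate «`PGL_3` acts freely on it», its quotient `barConf`, and — when the torus acts freely on the Schubert cell —
the quotient scheme `barGr`. **EXISTENCE / CONSTRUCTION NOT SHOWN IN PRINT ([Hu25] §9 reviews [La03]); NOT constructed
in this typing; secondary; primary unread (acq-07745).** The record asserts nothing; `Thm9_2` / `Thm9_4` are properties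
of such a datum. Universe `0`. [claim: Hu2025, status: under-review]
STATUS: candidate statement under adjudication (D-0012/D-0089); not asserted. -/
structure LafforgueObjects where
  /-- `C^{3,n}_d`, the configuration space of `n` points in `ℙ²` with spans prescribed by `d` -/
  conf : ∀ n : ℕ, HuMatroid n 3 → Scheme.{0}
  /-- «`PGL_3` acts freely on the configuration space `C^{3,n}_d`» -/
  PGLActsFreely : ∀ n : ℕ, HuMatroid n 3 → Prop
  /-- `C^{3,n}_d / PGL_3` -/
  barConf : ∀ n : ℕ, HuMatroid n 3 → Scheme.{0}
  /-- `Gr̄^{3,E}_d := Gr^{3,E}_d/(𝔾ⁿ_m/𝔾_m)` for a free torus action -/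
  barGr : ∀ (n : ℕ) (M : HuMatroid n 3), TorusFreeOnCell M → Scheme.{0}

/-- **«an affine scheme of finite type over `Spec ℤ`»** (Thm 9.2 / 9.4 hypothesis, chunk p0072 l.98, l.119): `X` affine
(Mathlib `IsAffine`) and the unique morphism `X → Spec ℤ` locally of finite type. OURS rendering (standard).
[claim: Hu2025, status: under-review]
STATUS: candidate statement under adjudication (D-0012/D-0089); not asserted. -/
def IsAffineFiniteTypeOverInt (X : Scheme.{0}) : Prop :=
  IsAffine X ∧ LocallyOfFiniteType (specZIsTerminal.from X)

/-- **Hu 2025, Theorem 9.2 (Mnëv, Theorem I.14, [La03])** (chunk p0072 l.97–104; PDF p.160; = [Hu22] Thm 9.2 p.130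
l.10–17), verbatim: «Let `X` be an affine scheme of finite type over `Spec ℤ`. Then, there exists a matroid `d` of rank
`3` on the set `[n]` such that `PGL_3` acts freely on the configuration space `C^{3,n}_d`. Further, there exists a
positive integer `r` and an open subset `U ⊂ X × 𝔸^r` projecting surjectively onto `X` such that `U` is isomorphic to
the quotient space `C^{3,n}_d := C^{3,n}_d/PGL_3`.» As a PROPERTY of a datum `L : LafforgueObjects` (AS RESTATED;
`X × 𝔸^r = 𝔸(Fin r; X)`; «positive integer `r`» typed `r : ℕ` — positivity imposes nothing). secondary: restated from
Lafforgue2003 Thm I.14; primary unread (acq-07745). [claim: Hu2025, status: under-review]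
STATUS: candidate statement under adjudication (D-0012/D-0089); not asserted. -/
def Thm9_2 (L : LafforgueObjects) : Prop :=
  ∀ X : Scheme.{0}, IsAffineFiniteTypeOverInt X →
    ∃ (n : ℕ) (M : HuMatroid n 3), L.PGLActsFreely n M ∧
      ∃ (r : ℕ) (U : (𝔸(Fin r; X)).Opens),
        _root_.AlgebraicGeometry.Surjective (U.ι ≫ (𝔸(Fin r; X) ↘ X)) ∧ Nonempty ((U : Scheme.{0}) ≅ L.barConf n M)

/-- **Hu 2025, Theorem 9.4 (Mnëv, Theorem I.14, [La03])** (chunk p0072 l.118–124; PDF p.161; = [Hu22] Thm 9.4 p.130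
l.39–50), verbatim: «Let `X` be an affine scheme of finite type over `Spec ℤ`. Then, there exists a matroid `d` of rank
`3` on the set `[n]` such that `(𝔾ⁿ_m/𝔾_m)` acts freely on the matroid Schubert cell `Gr^{3,E}_d`. Further, there exists
a positive integer `r` and an open subset `U ⊂ X × 𝔸^r` projecting onto `X` such that `U` is isomorphic to the quotient
space `Gr̄^{3,E}_d := Gr^{3,E}_d/(𝔾ⁿ_m/𝔾_m)`.» As a PROPERTY of a datum `L : LafforgueObjects` («acts freely» =
`TorusFreeOnCell` at field-valued points; «projecting onto `X`» read «surjectively», as Thm 9.2 prints). secondary: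
restated from Lafforgue2003 Thm I.14; primary unread (acq-07745). [claim: Hu2025, status: under-review]
STATUS: candidate statement under adjudication (D-0012/D-0089); not asserted. -/
def Thm9_4 (L : LafforgueObjects) : Prop :=
  ∀ X : Scheme.{0}, IsAffineFiniteTypeOverInt X →
    ∃ (n : ℕ) (M : HuMatroid n 3) (hfree : TorusFreeOnCell M) (r : ℕ) (U : (𝔸(Fin r; X)).Opens),
      _root_.AlgebraicGeometry.Surjective (U.ι ≫ (𝔸(Fin r; X) ↘ X)) ∧
        Nonempty ((U : Scheme.{0}) ≅ L.barGr n M hfree)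

/-! ## [Hu22] p.2 l.20–25 — «admits a resolution» and Theorem 1.1 of arXiv:2203.03842v4 (claim key Hu2022) -/

/-- **Hu 2022 (arXiv:2203.03842v4), p.2 l.20–22**, verbatim: «Let `X` be an integral affine or projective scheme of finite
presentation over a perfect field `k`. We say `X` admits a resolution if there exists a smooth scheme `X̃` over `k` and a
projective birational morphism from `X̃` onto `X`.» — the SAME phrase as [Hu25] p.158 L021–L024 (`S08MainTheorem.
AdmitsResolution`) with the base `k` PRINTED («smooth scheme `X̃` over `k`»): alias at `S = Spec k`.
[claim: Hu2022, status: under-review]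
STATUS: candidate statement under adjudication (D-0012/D-0089); not asserted. -/
abbrev Hu22AdmitsResolution {k : Type u} [Field k] {X : Scheme.{u}} (f : X ⟶ Spec (.of k)) : Prop :=
  AdmitsResolution f

/-- **Hu 2022 (arXiv:2203.03842v4), Theorem 1.1, p.2 l.23–25**, verbatim: «Theorem 1.1. (Resolution, Theorems 9.5 and 9.6)
Let `X` be an integral affine or projective scheme of finite presentation over a perfect field `k`. Assume further that
`X` is singular. Then, `X` admits a resolution.» — for every perfect field `k` (universe `u`) and `f : X ⟶ Spec k`:
`X` integral (Mathlib `IsIntegral`), affine (Mathlib `IsAffine X`) OR projective over `k` (tree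
`Motives.IsProjectiveOver (Over.mk f)`: a closed `k`-immersion into some `ℙⁿ_k`), `f` locally of finite presentation
(Mathlib `LocallyOfFinitePresentation`; `X` affine or projective is quasi-compact and separated, so this is «of finite
presentation»), singular in READING R-sm (`HuSingular f`) ⇒ `Hu22AdmitsResolution f`. This is the SUMMIT-TYPE claim whose
printed support is [Hu22] §9.2–9.3 (removed from [Hu25]; joint J2 = G-H10). [claim: Hu2022, status: under-review]
STATUS: candidate statement under adjudication (D-0012/D-0089); not asserted. -/
def Hu22Thm1_1 : Prop :=
  ∀ (k : Type u) [Field k] [PerfectField k] (X : Scheme.{u}) (f : X ⟶ Spec (.of k)),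
    IsIntegral X → (IsAffine X ∨ IsProjectiveOver (Over.mk f : SchemeOver k)) →
      LocallyOfFinitePresentation f → HuSingular f → Hu22AdmitsResolution f

/-- **Hu 2022, Theorem 1.1 in READING R-reg of «singular»** (sibling of `Hu22Thm1_1`, same locator p.2 l.23–25):
`¬ IsRegular X` in place of `¬ Smooth f`. [claim: Hu2022, status: under-review]
STATUS: candidate statement under adjudication (D-0012/D-0089); not asserted. -/
def Hu22Thm1_1_reg : Prop :=
  ∀ (k : Type u) [Field k] [PerfectField k] (X : Scheme.{u}) (f : X ⟶ Spec (.of k)),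
    IsIntegral X → (IsAffine X ∨ IsProjectiveOver (Over.mk f : SchemeOver k)) →
      LocallyOfFinitePresentation f → HuSingular_reg X → Hu22AdmitsResolution f

/-! ## [Hu22] p.132 l.26 – p.133 l.16 — the ring `𝔽[x, t, s^±]` and the sentence P133L11 (joint J2 = G-H10) -/

/-- **The ring `𝔽[x_1, ⋯, x_m, t_1, ⋯, t_r, s_1^±, ⋯, s_{n−1}^±]`** ([Hu22] p.132 l.26–29, l.46–58: «We let `x = (x_1, ⋯, x_m)`
be the affine coordinates of `𝔸^m` … and `t = (t_1, ⋯, t_r)` be the affine coordinates of `𝔸^r` … we take a split and let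
`(𝔾ⁿ_m/𝔾_m) ≅ 𝔾^{n−1}_m = Spec 𝔽[s_1^±, ⋯, s_{n−1}^±]` … a locally closed subset of `Spec 𝔽[x_1, ⋯, x_m, t_1, ⋯, t_r,
s_1^±, ⋯, s_{n−1}^±]`»): the polynomial ring in `x ⊔ t ⊔ s` localised away from `∏ s_j` (Mathlib `Localization.Away`).
OURS rendering (standard). [claim: Hu2022, status: under-review]
STATUS: candidate statement under adjudication (D-0012/D-0089); not asserted. -/
abbrev xtsRing (𝔽 : Type) [Field 𝔽] (m r n : ℕ) : Type :=
  Localization.Away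
    (∏ j : Fin (n - 1), (MvPolynomial.X (Sum.inr (Sum.inr j)) : MvPolynomial (Fin m ⊕ Fin r ⊕ Fin (n - 1)) 𝔽))

/-- **`𝔽[x] → 𝔽[x, t, s^±]`**, the inclusion of the polynomials in the `x`-variables only ([Hu22] p.133 l.13–14 «`g_i(x)` is
independent of the variables `t` and `s`»). OURS rendering. [claim: Hu2022, status: under-review]
STATUS: candidate statement under adjudication (D-0012/D-0089); not asserted. -/
def xIncl (𝔽 : Type) [Field 𝔽] (m r n : ℕ) : MvPolynomial (Fin m) 𝔽 →+* xtsRing 𝔽 m r n :=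
  (algebraMap (MvPolynomial (Fin m ⊕ Fin r ⊕ Fin (n - 1)) 𝔽) (xtsRing 𝔽 m r n)).comp
    (MvPolynomial.rename (Sum.inl : Fin m → Fin m ⊕ Fin r ⊕ Fin (n - 1))).toRingHom

/-- **Hu 2022 (arXiv:2203.03842v4), p.133 l.11–14** (joint J2 = G-H10), verbatim: «Then, by the construction of the
resolution `Z̃†_{ℓ,Γ} → Z_Γ`, we conclude that for every `i ∈ [k]`, `g_i(x, t, s) = g_i(x)` is independent of the
variables `t` and `s`.» Context (p.132 l.19–25, l.39–45, l.63–70, p.133 l.1–6, quoted, not reconstructed): «we can assume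
that `Gr̃_d → Gr_d` is the blowup of `Gr_d` along an ideal sheaf `J̃`» (Hartshorne II 7.17); «over `Gr_d` … a finite set
`{O}` of open subsets such that … (9.4) `Gr_d|_O ≅ O × (𝔾ⁿ_m/𝔾_m)`»; «we can suppose that the ideal `J̃|_O` … is generated
by `g_1(x,t,s), ⋯, g_k(x,t,s) ∈ J̃|_O ⊂ 𝔽[x, t, s^±]`, modulo the ideal of (the closure of) `Gr_d|_O` in `𝔽[x,t,s^±]`».
RING-level, PARAMETRIC typing: `IO` = the ideal of the closure of `Gr_d|_O` in `𝔽[x,t,s^±]` (`xtsRing`), `J` = the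
image of `J̃|_O` in `𝔽[x,t,s^±]/I_O`; the hypothesis that these ARE the printed objects (the trivialisation (9.4), the
blow-up ideal of `ϖ_Γ⁻¹(Gr_d) → Gr_d`) is the parameter `hSetup : Prop` (not constructible in this typing). CLAIM typed:
`J` is generated by (the classes of) finitely many polynomials in `x` alone. [claim: Hu2022, status: under-review]
STATUS: candidate statement under adjudication (D-0012/D-0089); not asserted. -/
def Hu22P133L11 {𝔽 : Type} [Field 𝔽] {m r n : ℕ} (hSetup : Prop) (IO : Ideal (xtsRing 𝔽 m r n))
    (J : Ideal (xtsRing 𝔽 m r n ⧸ IO)) : Prop :=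
  hSetup → ∃ (k : ℕ) (g : Fin k → MvPolynomial (Fin m) 𝔽),
    J = Ideal.span (Set.range fun i => Ideal.Quotient.mk IO (xIncl 𝔽 m r n (g i)))

/-! ## [Hu25] Thm 1.1 (chunk p0003 l.3–19; PDF p.3 L012–L020) and the two deduction sentences of §1.6 (chunk p0009 l.16–23; PDF p.17) -/

/-- **«defined over `ℤ`», READING** (the phrase of Thm 1.1, chunk p0003 l.7 «over a perfect field defined over `ℤ`,.» — sic,
the stray comma is printed; §8 preamble chunk p0067 l.6 «every scheme is defined over `ℤ`»; C09L16 «provided that `X` is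
defined over `ℤ`»; never defined in print): the `k`-scheme `f : X → Spec k` is a base change of an AFFINE scheme of finite
type over `Spec ℤ` — there are `X₀ → Spec ℤ` affine of finite type and `π : X → X₀` making `X` the fibre product
`X₀ ×_{Spec ℤ} Spec k` (Mathlib `IsPullback π f g₀ (Spec k → Spec ℤ)`). A READING, labelled.
[claim: Hu2025, status: under-review]
STATUS: candidate statement under adjudication (D-0012/D-0089); not asserted. -/
def IsDefinedOverInt {k : Type u} [Field k] {X : Scheme.{u}} (f : X ⟶ Spec (.of k)) : Prop :=
  ∃ (X₀ : Scheme.{u}) (g₀ : X₀ ⟶ Spec (.of (ULift.{u} ℤ))) (π : X ⟶ X₀),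
    IsAffine X₀ ∧ LocallyOfFiniteType g₀ ∧
      IsPullback π f g₀ (Spec.map (CommRingCat.ofHom ((Int.castRingHom k).comp ULift.ringEquiv.toRingHom)))

/-- **Hu 2025, Theorem 1.1 (Characteristic-free Resolution of Singularity Types)** (chunk p0003 l.3–19; PDF p.3 L012–L020),
verbatim: «Let `X` be an integral affine scheme of finite presentation over a perfect field defined over `ℤ`,. [sic]
Assume further that `X` is singular. Then, there exists a smooth morphism `Y → X` from a scheme `Y` onto `X`, a smooth
scheme `Ỹ` and a surjective proper birational morphism `Ỹ → Y`. … In such a case, we say `X` admits a resolution of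
singularity type.» For every perfect field `k` and `f : X ⟶ Spec k`: `X` integral, affine, `f` locally of finite
presentation, `X` defined over `ℤ` (READING `IsDefinedOverInt`), singular (READING R-sm) ⇒ `AdmitsResolutionType f`
(I-SM: the display (1.1) `Ỹ ⟶ Y ⟶ X`, with «smooth scheme `Ỹ`» read over `Spec k`). [claim: Hu2025, status: under-review]
STATUS: candidate statement under adjudication (D-0012/D-0089); not asserted. -/
def Thm1_1 : Prop :=
  ∀ (k : Type u) [Field k] [PerfectField k] (X : Scheme.{u}) (f : X ⟶ Spec (.of k)),
    IsIntegral X → IsAffine X → LocallyOfFinitePresentation f → IsDefinedOverInt f → HuSingular f →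
      AdmitsResolutionType f

/-- **Hu 2025, §1.6, the deduction sentence C09L16** (chunk p0009 l.16–19; PDF p.17 L033–L034), verbatim: «Theorem 1.1 is
obtained by applying Theorem 1.3, combining with Lafforgue's version of Mnëv's unversality [sic] theorem (Theorems 9.2 and
9.4), provided that `X` is defined over `ℤ`.» An INFERENCE sentence (joints J1 = G-H7 / J2 = G-H10 read it): typed as the
implication «Thm 1.3 ∧ Thm 9.2 ∧ Thm 9.4 ⇒ Thm 1.1» with the three premises as PARAMETERS (PARAMETRIC rendering; the
instance with this typing's own decls is `C09L16_inst`); «provided that `X` is defined over `ℤ`» is already a hypothesis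
inside `Thm1_1`. [claim: Hu2025, status: under-review]
STATUS: candidate statement under adjudication (D-0012/D-0089); not asserted. -/
def C09L16 (Thm13 Thm92 Thm94 : Prop) : Prop :=
  Thm13 → Thm92 → Thm94 → Thm1_1.{u}

/-- **Hu 2025, §1.6, the spreading-out sentence C09L21** (chunk p0009 l.21–23; PDF p.17 L035–L036), verbatim: «For a singular
affine or projective variety `X` over a general perfect field `k`, we spread it out and deduce that `X/k` admits a
resolution as well. The details are written in Part II.» Typed as the CLAIM it states (joint J2 = G-H10; Part II is not
posted): for every perfect field `k` and every `k`-VARIETY `X` (integral, separated and of finite type over `k`) that is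
affine or projective over `k` and singular (READING R-sm), `X/k` «admits a resolution» in the sense of p.158 L021–L024 /
[Hu22] p.2 (`AdmitsResolution f`, smoothness read over `k`). «we spread it out» names the intended method, not typed.
[claim: Hu2025, status: under-review]
STATUS: candidate statement under adjudication (D-0012/D-0089); not asserted. -/
def C09L21 : Prop :=
  ∀ (k : Type u) [Field k] [PerfectField k] (X : Scheme.{u}) (f : X ⟶ Spec (.of k)),
    IsIntegral X → IsSeparated f → LocallyOfFiniteType f → QuasiCompact f →
      (IsAffine X ∨ IsProjectiveOver (Over.mk f : SchemeOver k)) → HuSingular f → AdmitsResolution f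

end Literature.AlgebraicGeometry.Hu2025.Statements.S01S09Interface

end
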